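import Summits.CriticalPhenomena.PercolationContinuityZ3.Theorems.Transplant.SkelPhiEquilibriumBQ
import Summits.CriticalPhenomena.PercolationContinuityZ3.Theorems.Transplant.SkelPhiEquilibriumLimitsQ
import HarnessLib

/-!
# WAVE-Q binder row Q15 («SkelPhiEquilibriumBQ» ↦ «SkelPhiEquilibriumBQQ»): the ORIENTED equilibrium with the absolute shear bound, `Skelφ.Eq.exists_equilibriumWBQ`,
# re-typed under EXACT-FOOTPRINT QUASI-STEPS — `(hst : Skelφ.Steps G φ) ↦ {N : ℕ} (hq : Skelφ.QStepsN G φ N)`; the sentence is otherwise token for token the twin's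
# (the step hypothesis is only THREADED into Martineau–Tassion's Facts 1–2, whose `QStepsN` twins `fact1Q`/`fact2Q` are hp-8's α3-Q «SkelPhiEquilibriumLimitsQ» p506217)

builds on p205010 (kernel theorem, internal audit signed; external expert review pending) — nothing here uses p205010; nothing is claimed about any open node; no definition
(the predicate `Skelφ.EquilibriumAtWBQ` is the twin's, imported).  Lane `prim-bschramm`, seat `prim-bschramm-p3` gen 29 (design owner, porting in the binder wave under the
captain gen-1 g4; WAVE-Q-BINDER-rows-v0.6.tsv row Q15).  Helper file (`--supports stmt-CriticalPhenomena-4575 --as helper`).  Regression: at `N = 1` the hypothesis is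
supplied by `Skelφ.qStepsN_of_steps` and the statement is the twin's.
[cite: MartineauTassion2017, §3.2 Lemma 3.5 (pp. 9–11), Lemma 3.2] [cite: GrimmettPercolation1999, §11 (11.14)] [this work]
-/

noncomputable section

namespace Summit.CriticalPhenomena.PercolationContinuityZ3.Theorems.Transplant

namespace Skelφ

open MeasureTheory ProbabilityTheory Filter Topology Literature.Probability.Percolation Literature.Probability.LatticeModels SimpleGraph KNLevels
open scoped Classical

variable {V : Type} {G : SimpleGraph V}

namespace Eq

variable {φ : V → Site 2} {t : V}

/-- **Martineau–Tassion's Lemma 3.5 WITH THE SHEAR BOUND, FRAMES-ONLY (no central inversion)** (pieces fattened at the link-region scale; in an orientation where `¬ Good(n,0,3n)` the output has `|h| ≤ 10n`).  Hypotheses: the two-axis dictionary (`Lip`, `Steps`,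
`Frames`, Φ2 = `CylSubcritical`), `0 < p < 1`, a central inversion `ρ` at `t`, a `ρ`-invariant seed `SEED ∋ t` inside the zone `cyl t M` with
`P(SEED ↔ ∞) ≥ 1 − ε³²` (`0 < ε < 1`), the two `MeetsAS` inputs of Facts 1–2 (p1's (L0-2)), and radius data `R` (seed inside the fat prisms, `R ≥ 1`,
cylinder tails `≤ ε₀` beyond radius `R − 1`).  Conclusion: `EquilibriumAtW … M R (ε + ε₀) n` for all large `n`.
[cite: MartineauTassion2017, §3.2 Lemma 3.5] -/
theorem exists_equilibriumWBQ_q [Countable V] [G.LocallyFinite] {types : Finset V} (hlip : Lip G φ) {N : ℕ} (hq : QStepsN G φ N) (hfr : Frames G φ types)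
    {p : unitInterval} (hC : CylSubcritical G φ types p) (hp0 : 0 < (p : ℝ)) (hp1 : (p : ℝ) < 1) {M : ℕ} (hM : 1 ≤ M) (SEED : Finset V) (ht : t ∈ SEED) (hSM : (↑SEED : Set V) ⊆ cyl φ t M) (hQs : ∀ n, MeetsAS G p (strip φ t n)ᶜ) (hQx : ∀ σu : ℤˣ, MeetsAS G p (Xinf φ t (σu : ℤ) (M + 3))ᶜ)
    {ε ε₀ : ℝ} (hε0 : 0 < ε) (hε1 : ε < 1) (hseed : 1 - ε ^ 32 ≤ (bondPercolation G p).real (TwoAxis.SeedPerc (↑SEED : Set V))) (R : ℕ → ℕ)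
    (hR1 : ∀ L, M ≤ L → 1 ≤ R L) (hSR : ∀ L, M ≤ L → (↑SEED : Set V) ⊆ cylBall G φ t L (R L))
    (hRt : ∀ L, M ≤ L → (bondPercolation G p).real (⋃ b ∈ SEED, cylReach G φ t L (R L - 1) b) ≤ ε₀) :
    ∃ n₁, ∀ n, n₁ ≤ n → ¬ Good G φ t p ↑SEED n 0 (3 * n) → EquilibriumAtWBQ G φ p t SEED M R (ε + ε₀) n := by
  set μ := bondPercolation G p with hμ
  set M' := M + 3 with hM'
  have hSM' : (↑SEED : Set V) ⊆ cyl φ t M' := hSM.trans (cyl_mono φ t (by omega))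
  obtain ⟨nP, hnP⟩ := fact1Q (t := t) hlip hq hp0 hp1 (1 : ℤˣ) (M := M') (by omega) SEED ht hSM' (hQx 1)
  obtain ⟨nN, hnN⟩ := fact1Q (t := t) hlip hq hp0 hp1 (-1 : ℤˣ) (M := M') (by omega) SEED ht hSM' (hQx (-1))
  refine ⟨max (max nP nN) (M' + 1), fun n hn hnot3 => ?_⟩
  have hnP' : nP ≤ n := le_trans (le_trans (le_max_left _ _) (le_max_left _ _)) hn
  have hnN' : nN ≤ n := le_trans (le_trans (le_max_right _ _) (le_max_left _ _)) hn
  have hM'n : M' + 1 ≤ n := le_trans (le_max_right _ _) hn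
  have hn1 : 1 ≤ n := by omega
  have hε0' : 0 ≤ ε := hε0.le
  -- seed inside every `C(n,h,ℓ)` with `ℓ ≥ ℓ_B(n,h,M')`
  have hSC : ∀ (h : ℤ) (ℓ : ℕ), ℓB n h M' ≤ ℓ → (↑SEED : Set V) ⊆ pgramCyl φ t n h ℓ := fun h ℓ hℓ =>
    (hSM'.trans (cyl_subset_pgramCyl_ℓB (by omega) hn1 h)).trans (pgramCyl_mono t n h hℓ)
  -- (12) at every admissible `(h, ℓ)`
  have h12 : ∀ (h : ℤ) (ℓ : ℕ), ℓB n h M' ≤ ℓ → 1 - (ε ^ 16) ^ 2 ≤ μ.real (evLR φ t ↑SEED n h ℓ ∪ evUD φ t ↑SEED n h ℓ) := by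
    intro h ℓ hℓ
    have := real_seedPerc_le_evLR_union_evUD (t := t) hlip hfr hC hn1 SEED (hSC h ℓ hℓ)
    have e : (ε ^ 16) ^ 2 = ε ^ 32 := by ring
    rw [e]; exact hseed.trans this
  -- Fact 1: `Good` at `ℓ_B`; Fact 2: `¬ Good` eventually
  have hgoodB : ∀ h : ℤ, Good G φ t p ↑SEED n h (ℓB n h M') := by
    intro h
    rcases le_or_gt 0 h with hh | hh
    · exact (hnP n hnP' h (by rw [Units.val_one, one_mul, abs_of_nonneg hh])).le
    · exact (hnN n hnN' h (by rw [Units.val_neg, Units.val_one, neg_one_mul, abs_of_neg hh])).le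
  have hL : ∀ h : ℤ, ∃ L, ℓB n h M' ≤ L ∧ ∀ ℓ, L < ℓ → ¬ Good G φ t p ↑SEED n h ℓ := by
    intro h
    obtain ⟨ℓ₁, hℓ₁⟩ := fact2Q (t := t) hlip hq hp0 hp1 hn1 h SEED ht (hSC h _ le_rfl) (hQs n)
    refine ⟨max ℓ₁ (ℓB n h M'), le_max_right _ _, fun ℓ hℓ hg => ?_⟩
    have := hℓ₁ ℓ (le_of_lt (lt_of_le_of_lt (le_max_left _ _) hℓ))
    unfold Good at hg
    linarith
  choose L hLB hLnot using hL
  -- the equilibrium height as a function of the shear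
  set leq : ℤ → ℕ := fun h => ℓeq G φ t p ↑SEED n h (ℓB n h M') (L h) with hleq
  have hleq_spec : ∀ h, ℓB n h M' ≤ leq h ∧ Good G φ t p ↑SEED n h (leq h) := fun h =>
    ⟨(ℓeq_spec p (hLB h) (hgoodB h)).1, (ℓeq_spec p (hLB h) (hgoodB h)).2.2⟩
  have hleq_not : ∀ h ℓ, leq h < ℓ → ¬ Good G φ t p ↑SEED n h ℓ := by
    intro h ℓ hℓ
    rcases le_or_gt ℓ (L h) with h1 | h1
    · exact not_good_of_ℓeq_lt p (hLB h) (hgoodB h) hℓ h1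
    · exact hLnot h ℓ h1
  have hleq_max : ∀ h ℓ, ℓB n h M' ≤ ℓ → Good G φ t p ↑SEED n h ℓ → ℓ ≤ leq h := by
    intro h ℓ _ hg; by_contra hlt; exact hleq_not h ℓ (not_le.1 hlt) hg
  -- the optimal shear (a finite window suffices)
  set H : ℕ := n * (leq 0 + 1) with hH
  obtain ⟨h₀, hh₀W, hmin⟩ := Finset.exists_min_image (Finset.Icc (-(H : ℤ)) H) leq ⟨0, by simp⟩
  have hopt : ∀ h : ℤ, leq h₀ ≤ leq h := by
    intro h
    by_cases hw : h ∈ Finset.Icc (-(H : ℤ)) H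
    · exact hmin h hw
    · rw [Finset.mem_Icc, not_and_or, not_le, not_le] at hw
      have habs : H < h.natAbs := by rcases hw with hw | hw <;> omega
      have h1 := le_mul_ℓB_succ hn1 h M'
      have h2 : n * (leq 0 + 1) < n * (ℓB n h M' + 1) := by
        calc n * (leq 0 + 1) = H := rfl
          _ < h.natAbs := habs
          _ ≤ (M' + 1) * (n + h.natAbs) := by nlinarith
          _ ≤ _ := h1
      have h3 : leq 0 < ℓB n h M' := by have := Nat.lt_of_mul_lt_mul_left h2; omega
      exact ((hmin 0 (by simp)).trans h3.le).trans (hleq_spec h).1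
  -- THE SHEAR BOUND (orientation with `ℓ_eq(n,0) < 3n`): steep shears are never minimisers
  have hℓB0 : ℓB n 0 M' < n := by
    have h1 := mul_ℓB_lt hn1 0 M'
    simp only [Int.natAbs_zero, Nat.add_zero] at h1
    have h2 : (M' + 1) * n ≤ n * n := Nat.mul_le_mul_right _ hM'n
    exact Nat.lt_of_mul_lt_mul_left (h1.trans_le h2)
  have hleq0 : leq 0 < 3 * n := by
    by_contra hc
    exact hnot3 (good_of_le hlip p (hSC 0 _ le_rfl) (by omega) (not_lt.1 hc) (hleq_spec 0).2)
  have hsteep : ∀ h : ℤ, 7 * (n : ℤ) ≤ |h| → leq 0 < leq h := by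
    intro h hh
    set ℓ₁ : ℕ := leq 0 + 1 with hℓ₁
    rcases lt_or_ge ℓ₁ (ℓB n h M') with hB | hB
    · exact lt_of_lt_of_le (by omega) (hleq_spec h).1
    refine lt_of_lt_of_le (Nat.lt_succ_self _) (hleq_max h ℓ₁ hB ?_)
    -- `Good(n,h,ℓ₁)` by the chain `LR_h ⊆ UD(0,3n)`, `¬Good(0,3n)`, `LR(0,3n) ⊆ UD_h`
    have hSh : (↑SEED : Set V) ⊆ pgramCyl φ t n h ℓ₁ := hSC h ℓ₁ hB
    have hST : (↑SEED : Set V) ⊆ pgramCyl φ t n 0 (3 * n) := hSC 0 _ (by omega)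
    -- heights on the sides of `C(n,h,ℓ₁)` are beyond `3n`
    have hfar : ∀ w, w ∈ pgramCyl φ t n h ℓ₁ → |relCoord φ t 0 w| = n → 3 * (n : ℤ) < |relCoord φ t 1 w| := by
      intro w hw hα
      rcases (abs_eq (by positivity : (0 : ℤ) ≤ n)).1 hα with hα' | hα'
      · have hb := height_bounds_of_side φ t hn1 (Or.inl rfl) hw (by rw [hα', one_mul])
        rw [one_mul] at hb
        have : (ℓ₁ : ℤ) ≤ 3 * n := by exact_mod_cast (by omega : ℓ₁ ≤ 3 * n)
        rcases le_or_gt 0 h with h0 | h0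
        · rw [abs_of_nonneg h0] at hh; rw [lt_abs]; left; linarith
        · rw [abs_of_neg h0] at hh; rw [lt_abs]; right; linarith
      · have hb := height_bounds_of_side φ t hn1 (Or.inr rfl) hw (by rw [hα', neg_one_mul])
        rw [neg_one_mul] at hb
        have : (ℓ₁ : ℤ) ≤ 3 * n := by exact_mod_cast (by omega : ℓ₁ ≤ 3 * n)
        rcases le_or_gt 0 h with h0 | h0
        · rw [abs_of_nonneg h0] at hh; rw [lt_abs]; right; linarith
        · rw [abs_of_neg h0] at hh; rw [lt_abs]; left; linarith
    have mono_ae : ∀ {X Y : Set (BondConfig V)}, (∀ ω : BondConfig V, ω ⊆ G.edgeSet → ω ∈ X → ω ∈ Y) → μ.real X ≤ μ.real Y := by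
      intro X Y hXY
      rw [measureReal_def, measureReal_def]
      refine ENNReal.toReal_mono (measure_ne_top _ _) (measure_mono_ae ?_)
      filter_upwards [(setBernoulli_ae_subset : ∀ᵐ ω ∂μ, ω ⊆ G.edgeSet)] with ω hω hX
      exact hXY ω hω hX
    have cA : μ.real (evLR φ t ↑SEED n h ℓ₁) ≤ μ.real (evUD φ t ↑SEED n 0 (3 * n)) := by
      refine mono_ae fun ω hω hev => ?_
      obtain ⟨b, hb, y, hy, hc⟩ := hev
      rw [mem_LRset] at hy
      have hyT : y ∉ pgramCyl φ t n 0 (3 * n) := by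
        intro hyT; rw [mem_pgramCyl_zero hn1] at hyT; have := hfar y hy.1 hy.2; have := hyT.2; push_cast at this; omega
      obtain ⟨z, hz, u, hu, huT, hzu, hbz⟩ := TwoAxis.exists_exit_of_openConnIn (S := pgramCyl φ t n 0 (3 * n)) (hST hb) hyT hc
      have hadj : G.Adj z u := hω ((openGraph_adj ω z u).1 hzu).1
      refine ⟨b, hb, z, (mem_UDset_zero hn1).2 ⟨hz, ?_⟩, hbz⟩
      rw [mem_pgramCyl_zero hn1] at hz
      have hαu : |relCoord φ t 0 u| ≤ n := ((mem_pgramCyl).1 hu).1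
      have hβu : 3 * (n : ℤ) < |relCoord φ t 1 u| := by
        by_contra hc'; exact huT ((mem_pgramCyl_zero hn1).2 ⟨hαu, by push_cast; exact not_lt.1 hc'⟩)
      have h1 := abs_relCoord_sub_le_of_adj (t := t) hlip hadj 1
      have := abs_sub_abs_le_abs_sub (relCoord φ t 1 u) (relCoord φ t 1 z)
      rw [abs_sub_comm] at h1
      have := hz.2; push_cast at this ⊢; omega
    have cB : μ.real (evUD φ t ↑SEED n 0 (3 * n)) ≤ μ.real (evLR φ t ↑SEED n 0 (3 * n)) := by
      unfold Good at hnot3; exact le_of_lt (not_le.1 hnot3)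
    have cC : μ.real (evLR φ t ↑SEED n 0 (3 * n)) ≤ μ.real (evUD φ t ↑SEED n h ℓ₁) := by
      refine mono_ae fun ω hω hev => ?_
      obtain ⟨b, hb, y, hy, hc⟩ := hev
      rw [mem_LRset, mem_pgramCyl_zero hn1] at hy
      have hyC : y ∉ pgramCyl φ t n h ℓ₁ := by
        intro hyC; have := hfar y hyC hy.2; have := hy.1.2; push_cast at this; omega
      obtain ⟨z, hzB, hzT, hbz⟩ := exists_exit_pgramCyl hlip hω ⟨hSh hb, hST hb⟩ hyC hc
      have hzT' := hzT
      rw [mem_pgramCyl_zero hn1] at hzT'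
      rw [pgBoundary_eq_union] at hzB
      rcases hzB with hzL | hzU
      · exfalso
        rw [mem_LRset] at hzL
        have := hfar z hzL.1 hzL.2; have := hzT'.2; push_cast at this; omega
      · exact ⟨b, hb, z, hzU, openConnIn_mono Set.inter_subset_left b z hbz⟩
    unfold Good; linarith
  have hh₀7 : |h₀| < 7 * (n : ℤ) := by
    by_contra hc; push Not at hc
    have := hsteep h₀ hc; have := hopt 0; omega
  -- `ℓ₀ := ℓ_eq(h₀) + 1`: the sides are likely (19)
  set ℓ₀ : ℕ := leq h₀ + 1 with hℓ₀
  have hℓ₀B : ℓB n h₀ M' ≤ ℓ₀ := (hleq_spec h₀).1.trans (Nat.le_succ _)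
  have hℓ₀5 : 5 ≤ ℓ₀ := by have h1 := le_ℓB hn1 h₀ M'; have h2 := (hleq_spec h₀).1; have h3 : M' = M + 3 := hM'; omega
  have hLR : 1 - ε ^ 16 ≤ μ.real (evLR φ t ↑SEED n h₀ ℓ₀) := by
    have := real_evLR_ge_of_not_good p (hleq_not h₀ ℓ₀ (Nat.lt_succ_self _)) (h12 h₀ ℓ₀ hℓ₀B)
    rwa [sqrt_sq_pow hε0' 16] at this
  -- NO SYMMETRY (MT17 (21) in max form): ONE of the two full sides carries `1 − ε⁸`
  set Tp : Set V := sideSeg φ t n h₀ ℓ₀ 1 (h₀ - ℓ₀) (h₀ + ℓ₀) with hTp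
  set Tm : Set V := sideSeg φ t n h₀ ℓ₀ (-1) (h₀ - ℓ₀) (h₀ + ℓ₀) with hTm
  have hLRT : evLR φ t ↑SEED n h₀ ℓ₀ = evPiece φ t ↑SEED n h₀ ℓ₀ Tp ∪ evPiece φ t ↑SEED n h₀ ℓ₀ Tm := by
    rw [← evPiece_union, hTp, hTm, sideSeg_full_eq φ t hn1 h₀ ℓ₀ (Or.inl rfl), sideSeg_full_eq φ t hn1 h₀ ℓ₀ (Or.inr rfl), evLR,
      LRset_eq_union]; rfl
  obtain ⟨σ₀, hσ₀, hside⟩ : ∃ σ₀ : ℤ, (σ₀ = 1 ∨ σ₀ = -1) ∧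
      1 - ε ^ 8 ≤ μ.real (evPiece φ t ↑SEED n h₀ ℓ₀ (sideSeg φ t n h₀ ℓ₀ σ₀ (h₀ - ℓ₀) (h₀ + ℓ₀))) := by
    have e : ε ^ 16 = (ε ^ 8) ^ 2 := by ring
    rw [hLRT, e] at hLR
    rcases ge_or_ge_of_union p (isUpperSet_evPiece φ t _ n h₀ ℓ₀ _) (isUpperSet_evPiece φ t _ n h₀ ℓ₀ _)
      (IsoradialArmExtension.measurableSet_openCrossing' _ _ _) (IsoradialArmExtension.measurableSet_openCrossing' _ _ _) hLR with h1 | h1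
    · rw [sqrt_sq_pow hε0' 8] at h1; exact ⟨1, Or.inl rfl, h1⟩
    · rw [sqrt_sq_pow hε0' 8] at h1; exact ⟨-1, Or.inr rfl, h1⟩
  set T : Set V := sideSeg φ t n h₀ ℓ₀ σ₀ (h₀ - ℓ₀) (h₀ + ℓ₀) with hT
  -- thirds (20): a sub-segment `[x, y] ⊆ [h₀ − ℓ₀, h₀ + ℓ₀]` of length `≤ d` carries `1 − ε²`
  set d : ℕ := (2 * ℓ₀ + 2) / 3 with hd
  have hd3 : 2 * ℓ₀ ≤ 3 * d + 0 := by omega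
  have hthird : ∃ x y : ℤ, h₀ - ℓ₀ ≤ x ∧ x ≤ y ∧ y ≤ h₀ + ℓ₀ ∧ y - x ≤ d ∧
      1 - ε ^ 2 ≤ μ.real (evPiece φ t ↑SEED n h₀ ℓ₀ (sideSeg φ t n h₀ ℓ₀ σ₀ x y)) := by
    set T1 := sideSeg φ t n h₀ ℓ₀ σ₀ (h₀ - ℓ₀) (h₀ - ℓ₀ + d) with hT1
    set T2 := sideSeg φ t n h₀ ℓ₀ σ₀ (h₀ - ℓ₀ + d) (h₀ + ℓ₀ - d) with hT2
    set T3 := sideSeg φ t n h₀ ℓ₀ σ₀ (h₀ + ℓ₀ - d) (h₀ + ℓ₀) with hT3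
    have hcov : T ⊆ T1 ∪ (T2 ∪ T3) := by
      intro w hw
      rw [hT, mem_sideSeg] at hw
      obtain ⟨hC', hα, hlo, hhi⟩ := hw
      simp only [hT1, hT2, hT3, Set.mem_union, mem_sideSeg]
      rcases le_or_gt (σ₀ * relCoord φ t 1 w) (h₀ - ℓ₀ + d) with h1 | h1
      · exact Or.inl ⟨hC', hα, hlo, h1⟩
      · rcases le_or_gt (σ₀ * relCoord φ t 1 w) (h₀ + ℓ₀ - d) with h2 | h2
        · exact Or.inr (Or.inl ⟨hC', hα, h1.le, h2⟩)
        · exact Or.inr (Or.inr ⟨hC', hα, h2.le, hhi⟩)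
    have hU : 1 - (ε ^ 4) ^ 2 ≤ μ.real (evPiece φ t ↑SEED n h₀ ℓ₀ T1 ∪ evPiece φ t ↑SEED n h₀ ℓ₀ (T2 ∪ T3)) := by
      rw [← evPiece_union]
      have e : (ε ^ 4) ^ 2 = ε ^ 8 := by ring
      rw [e]; exact hside.trans (measureReal_mono (evPiece_mono φ t ↑SEED n h₀ ℓ₀ hcov))
    rcases ge_or_ge_of_union p (isUpperSet_evPiece φ t _ n h₀ ℓ₀ _) (isUpperSet_evPiece φ t _ n h₀ ℓ₀ _)
      (IsoradialArmExtension.measurableSet_openCrossing' _ _ _) (IsoradialArmExtension.measurableSet_openCrossing' _ _ _) hU with h1 | h1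
    · rw [sqrt_sq_pow hε0' 4] at h1
      have hε4 : ε ^ 4 ≤ ε ^ 2 := pow_le_pow_of_le_one hε0' hε1.le (by norm_num)
      exact ⟨h₀ - ℓ₀, h₀ - ℓ₀ + d, le_rfl, by omega, by omega, by omega, by linarith⟩
    · rw [sqrt_sq_pow hε0' 4, evPiece_union] at h1
      have e : ε ^ 4 = (ε ^ 2) ^ 2 := by ring
      rw [e] at h1
      rcases ge_or_ge_of_union p (isUpperSet_evPiece φ t _ n h₀ ℓ₀ _) (isUpperSet_evPiece φ t _ n h₀ ℓ₀ _)
        (IsoradialArmExtension.measurableSet_openCrossing' _ _ _) (IsoradialArmExtension.measurableSet_openCrossing' _ _ _) h1 with h2 | h2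
      · rw [sqrt_sq_pow hε0' 2] at h2
        exact ⟨h₀ - ℓ₀ + d, h₀ + ℓ₀ - d, by omega, by omega, by omega, by omega, h2⟩
      · rw [sqrt_sq_pow hε0' 2] at h2
        exact ⟨h₀ + ℓ₀ - d, h₀ + ℓ₀, by omega, by omega, le_rfl, by omega, h2⟩
  obtain ⟨x, y, hx, hxy, hy, hyx, hxyP⟩ := hthird
  have e2 : ε ^ 2 = (ε ^ 1) ^ 2 := by ring
  rw [e2] at hxyP
  obtain ⟨u, hxu, huy, hPdown, hPup⟩ := exists_split_side φ t p (↑SEED) n h₀ ℓ₀ σ₀ hxy (by positivity)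
    (by rw [← e2]; exact pow_lt_one₀ hε0' hε1 (by norm_num)) hxyP
  rw [sqrt_sq_pow hε0' 1, pow_one] at hPdown hPup
  set ℓ : ℕ := leq u with hℓdef
  have hℓB : ℓB n u M' ≤ ℓ := (hleq_spec u).1
  have hℓ₀ℓ : ℓ₀ ≤ ℓ + 1 := by have := hopt u; omega
  have hdℓ : (d : ℤ) ≤ ℓ := by have h1 : d ≤ ℓ := by omega
                               exact_mod_cast h1
  have h23 : 2 * ℓ₀ ≤ 3 * ℓ := by omega
  have huh₀ : |u - h₀| ≤ ℓ₀ := abs_le.2 ⟨by omega, by omega⟩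
  have hCC : pgramCyl φ t n h₀ ℓ₀ ⊆ pgramCyl φ t n u (3 * ℓ) := pgramCyl_subset_recentre huh₀ h23
  have hmulB := le_mul_ℓB_succ hn1 u M'
  have hmul : (M + 4) * (n + u.natAbs) ≤ n * (ℓ + 1) := by
    calc (M + 4) * (n + u.natAbs) = (M' + 1) * (n + u.natAbs) := by rw [hM']
      _ ≤ n * (ℓB n u M' + 1) := hmulB
      _ ≤ n * (ℓ + 1) := Nat.mul_le_mul_left _ (by omega)
  -- the top layer: Good at `ℓ_eq(u)` (17); NO SYMMETRY (MT17 (26) in max form): ONE of top/bottom carries `1 − ε⁸`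
  have hUD : 1 - ε ^ 16 ≤ μ.real (evUD φ t ↑SEED n u ℓ) := by
    have := real_evUD_ge_of_good p (hleq_spec u).2 (h12 u ℓ hℓB)
    rwa [sqrt_sq_pow hε0' 16] at this
  have hUDT : evUD φ t ↑SEED n u ℓ =
      evPiece φ t ↑SEED n u ℓ (topSeg φ t n u ℓ 1 (-(n : ℤ)) n) ∪ evPiece φ t ↑SEED n u ℓ (topSeg φ t n u ℓ (-1) (-(n : ℤ)) n) := by
    rw [← evPiece_union, evUD, UDset_eq_union]; rfl
  obtain ⟨σ₁, hσ₁, htop⟩ : ∃ σ₁ : ℤ, (σ₁ = 1 ∨ σ₁ = -1) ∧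
      1 - (ε ^ 4) ^ 2 ≤ μ.real (evPiece φ t ↑SEED n u ℓ (topSeg φ t n u ℓ σ₁ (-(n : ℤ)) n)) := by
    have e : ε ^ 16 = (ε ^ 8) ^ 2 := by ring
    have e' : ε ^ 8 = (ε ^ 4) ^ 2 := by ring
    rw [hUDT, e] at hUD
    rcases ge_or_ge_of_union p (isUpperSet_evPiece φ t _ n u ℓ _) (isUpperSet_evPiece φ t _ n u ℓ _)
      (IsoradialArmExtension.measurableSet_openCrossing' _ _ _) (IsoradialArmExtension.measurableSet_openCrossing' _ _ _) hUD with h1 | h1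
    · rw [sqrt_sq_pow hε0' 8, e'] at h1; exact ⟨1, Or.inl rfl, h1⟩
    · rw [sqrt_sq_pow hε0' 8, e'] at h1; exact ⟨-1, Or.inr rfl, h1⟩
  obtain ⟨v, hvlo, hvhi, hPleft, hPright⟩ := exists_split_top φ t p (↑SEED) n u ℓ σ₁ (x := -(n : ℤ)) (y := n) (by omega) (by positivity)
    (pow_lt_one₀ (by positivity) (pow_lt_one₀ hε0' hε1 (by norm_num)) (by norm_num)) htop
  rw [sqrt_sq_pow hε0' 4] at hPleft hPright
  have hε4 : ε ^ 4 ≤ ε := by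
    calc ε ^ 4 ≤ ε ^ 1 := pow_le_pow_of_le_one hε0' hε1.le (by norm_num)
      _ = ε := pow_one ε
  set L3 : ℕ := pgScale n u (3 * ℓ) with hL3
  have hML3 : M ≤ L3 := by have : n ≤ L3 := le_max_left _ _; omega
  set R₀ : ℕ := R L3 - 1 with hR₀
  have hRL3 : R L3 = R₀ + 1 := by have := hR1 L3 hML3; omega
  have hBall : (↑SEED : Set V) ⊆ cylBall G φ t (pgScale n u (3 * ℓ)) (R₀ + 1) := by rw [← hRL3]; exact hSR L3 hML3
  have htail : μ.real (⋃ b ∈ SEED, cylReach G φ t (pgScale n u (3 * ℓ)) R₀ b) ≤ ε₀ := hRt L3 hML3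
  -- the two halves of the preferred vertical side
  have hup : 1 - (ε + ε₀) ≤ μ.real (linkIn (pgramPrism G φ t n u (3 * ℓ) (R L3)) SEED (pgSideHalfW G φ t n u ℓ (R L3) σ₀ σ₀)) := by
    rw [hRL3]
    have := real_evPiece_le_linkIn_add (t := t) p hn1 u ℓ R₀ hCC SEED hBall (T := sideSeg φ t n h₀ ℓ₀ σ₀ u y)
      (F := pgSideHalfW G φ t n u ℓ (R₀ + 1) σ₀ σ₀)
      (fun y' hy' hT' => (mem_pgSideHalfW G φ).2 ⟨hy', sideSeg_subset_half_up' hσ₀ (by omega) hT'⟩)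
    have hP : 1 - ε ≤ μ.real (openCrossing (pgramCyl φ t n h₀ ℓ₀) ↑SEED (sideSeg φ t n h₀ ℓ₀ σ₀ u y)) := hPup
    linarith
  have hdown : 1 - (ε + ε₀) ≤ μ.real (linkIn (pgramPrism G φ t n u (3 * ℓ) (R L3)) SEED (pgSideHalfW G φ t n u ℓ (R L3) σ₀ (-σ₀))) := by
    rw [hRL3]
    have := real_evPiece_le_linkIn_add (t := t) p hn1 u ℓ R₀ hCC SEED hBall (T := sideSeg φ t n h₀ ℓ₀ σ₀ x u)
      (F := pgSideHalfW G φ t n u ℓ (R₀ + 1) σ₀ (-σ₀))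
      (fun y' hy' hT' => (mem_pgSideHalfW G φ).2 ⟨hy', sideSeg_subset_half_down' hσ₀ (by omega) hT'⟩)
    have hP : 1 - ε ≤ μ.real (openCrossing (pgramCyl φ t n h₀ ℓ₀) ↑SEED (sideSeg φ t n h₀ ℓ₀ σ₀ x u)) := hPdown
    linarith
  have hsideP : ∀ τ : ℤ, (τ = 1 ∨ τ = -1) →
      1 - (ε + ε₀) ≤ μ.real (linkIn (pgramPrism G φ t n u (3 * ℓ) (R L3)) SEED (pgSideHalfW G φ t n u ℓ (R L3) σ₀ τ)) := by
    intro τ hτ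
    rcases hσ₀ with rfl | rfl <;> rcases hτ with rfl | rfl
    · exact hup
    · exact hdown
    · simpa using hdown
    · exact hup
  -- the two pieces of the preferred slanted side
  have htopP : ∀ τ : ℤ, (τ = 1 ∨ τ = -1) →
      1 - (ε + ε₀) ≤ μ.real (linkIn (pgramPrism G φ t n u (3 * ℓ) (R L3)) SEED (pgTopPieceW G φ t n u ℓ (R L3) σ₁ τ v)) := by
    intro τ hτ
    rw [hRL3]
    have hCu : pgramCyl φ t n u ℓ ⊆ pgramCyl φ t n u (3 * ℓ) := pgramCyl_mono t n u (by omega)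
    rcases hτ with rfl | rfl
    · have := real_evPiece_le_linkIn_add (t := t) p hn1 u ℓ R₀ hCu SEED hBall (T := topSeg φ t n u ℓ σ₁ v n)
        (F := pgTopPieceW G φ t n u ℓ (R₀ + 1) σ₁ 1 v)
        (fun y' hy' hT' => (mem_pgTopPieceW G φ).2 ⟨hy', topSeg_subset_piece' (Or.inl ⟨rfl, rfl, rfl⟩) hT'⟩)
      have hP : 1 - ε ^ 4 ≤ μ.real (openCrossing (pgramCyl φ t n u ℓ) ↑SEED (topSeg φ t n u ℓ σ₁ v n)) := hPright
      linarith
    · have := real_evPiece_le_linkIn_add (t := t) p hn1 u ℓ R₀ hCu SEED hBall (T := topSeg φ t n u ℓ σ₁ (-(n : ℤ)) v)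
        (F := pgTopPieceW G φ t n u ℓ (R₀ + 1) σ₁ (-1) v)
        (fun y' hy' hT' => (mem_pgTopPieceW G φ).2 ⟨hy', topSeg_subset_piece' (Or.inr ⟨rfl, rfl, rfl⟩) hT'⟩)
      have hP : 1 - ε ^ 4 ≤ μ.real (openCrossing (pgramCyl φ t n u ℓ) ↑SEED (topSeg φ t n u ℓ σ₁ (-(n : ℤ)) v)) := hPleft
      linarith
  have huabs : u.natAbs ≤ 10 * n := by
    have h1 : |u| < 10 * (n : ℤ) := by
      have : (ℓ₀ : ℤ) ≤ 3 * n := by have := hopt 0; exact_mod_cast (by omega : ℓ₀ ≤ 3 * n)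
      have hu1 : |u - h₀| ≤ ℓ₀ := huh₀
      have := abs_sub_abs_le_abs_sub u h₀
      linarith
    have h2 : (u.natAbs : ℤ) ≤ 10 * n := by rw [Int.natCast_natAbs]; exact h1.le
    exact_mod_cast h2
  refine ⟨σ₀, σ₁, u, ℓ, v, hσ₀, hσ₁, huabs, by omega, ?_, abs_le.2 ⟨hvlo, hvhi⟩, ?_, fun σ τ hσ _ =>
    ⟨disjoint_pgSideHalfW_cyl t (by omega) u ℓ _ hσ τ, disjoint_pgTopPieceW_cyl t hn1 hmul _ hσ τ v⟩, fun τ hτ => ⟨hsideP τ hτ, htopP τ hτ⟩⟩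
  · have := le_ℓB hn1 u M'; omega
  · have : (M + 1) * (n + u.natAbs) ≤ n * (ℓ + 1) := le_trans (Nat.mul_le_mul_right _ (by omega)) hmul
    exact_mod_cast this

end Eq

end Skelφ

end Summit.CriticalPhenomena.PercolationContinuityZ3.Theorems.Transplant

end
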